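import Mathlib

/-!
# Tier4/LitPeriod — Bergeron's theta-series classes on compact arithmetic quotients, AS PRINTED (named Props, no proofs)

Blind re-derivation cell `pub-hodge-repro`, Tier 4, literature seat `t4-lit-5` (gen 0).  Tree path
`lean/Summits/Ventures/HodgeRepro/Tier4/LitPeriod.lean` (HOME copy `lit/t4/Tier4LitPeriod.lean`).
Imports: Mathlib only.  NOTHING is proved here (seat rule: printed theorems are typed as named Props with their
hypotheses explicit; a line that consumes one displays it as a hypothesis of a LEMMA, never of `P_T4`).

## Source (read on the materialised page files; paper rows I-t4-lit-5-11 … I-t4-lit-5-20 of proofs/t4/inputs/t4-lit-5.md)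
[BP] N. Bergeron, *Produits dans la cohomologie des variétés arithmétiques : quelques calculs sur les séries thêta*,
arXiv:math/0612447 (2006) — store key `paper:arxiv-math_0612447`, arXiv AUTHOR COPY (no journal print located;
README §8(iv): everything below is «closed on author copy» until a print is deposited).

Setting as printed (p0002:L5–L12, L26–L28, L56): `k` a totally real field (orthogonal case) or a totally imaginary
quadratic extension of one (unitary case; `k_0` its real subfield), `V_k` a non-degenerate ANISOTROPIC quadratic
(resp. hermitian) space of signature `(p, q)` at ONE archimedean place and positive definite at the others; `G` the
ℚ-group of isometries (restriction of scalars); `S(Γ) = Γ\D⁺` the COMPACT quotients by congruence subgroups;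
`H^*(Sh^0 G) = lim_→Γ H^*(S(Γ))` (complex coefficients).  The group `G(𝔸_f)` acts on the theta classes through its
action on the finite Schwartz function `φ ∈ 𝒮(X(𝔸_f))` (p0004:L9–L11) — these are the HECKE TRANSLATES.
Theta classes (p0003:L68–L84): for a dual pair `(U(r,s), U(p,q))` (resp. `(Sp(2r), O(p,q))`), `g′ ∈ G̃′(𝔸)` and
`φ ∈ 𝒮(X(𝔸_f))`, the theta series `θ(g′, φ)` with the Schwartz form `φ^{(rq,sq)}` at the first archimedean place
is a closed `(r+s)q`-form on `Sh(G)_K`; its class `[θ(g′, φ)] ∈ H^{(r+s)q}(Sh^0 G)` is called «defined by a theta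
series» «of bidegree `(rq, sq)`».  For `(r, s) = (1, 0)` these are the Kazhdan / Shimura / Borel–Wallach classes and
`[θ(g′, φ)] ≠ 0` in `H^q(Sh^0 G)` (display (BW), p0003:L86–L89).

## The interface
The printed statements quantify over: classes of `H^*(Sh^0 G)` (a ℂ-vector space with the cup product), the
`G(𝔸_f)`-action, complex conjugation of classes (`φ^{(0,q)} = \overline{φ^{(q,0)}}`, p0004:L43–L44), and the
predicate «is a class defined by a theta series of bidegree `(rq, sq)`».  `ThetaClassData` below carries exactly
these; every statement is then a named `Prop` over it.  What the interface does NOT encode (and so what a consumer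
must match by hand): that `Cls` really is `H^*(Sh^0 G)` of the space named in (P) (a Picard modular surface has
`p = 2`, `q = 1`), that `cup` is the cup product, that `act` is the action through `φ`, and that `IsTheta` is
Bergeron's class of theta series — the docstrings say what each field stands for on the page.
-/

set_option autoImplicit false

noncomputable section

namespace Summit.Ventures.HodgeRepro.Tier4.Lit

/-- The cohomological data of [BP] §1 over which Théorèmes 1.1–1.2 and §4 are stated (see the module docstring).
* `p q` — the signature of `V` at the one indefinite archimedean place (p0002:L9–L10).
* `Cls` (parameter, a ℂ-vector space) — `H^*(Sh^0 G) = lim_→Γ H^*(S(Γ))`, complex coefficients (p0002:L56); `cup` its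
  cup product, `one` the unit.
* `G` (parameter, a group) — the finite adèlic group `G(𝔸_f)`; `act g c` = the Hecke translate `g(c)` (p0004:L9–L11).
* `conj` — complex conjugation of classes (the conjugate of a `(rq,sq)` theta class is a `(sq,rq)` theta class,
  p0004:L19–L21 with `φ^{(0,q)} = \overline{φ^{(q,0)}}`, p0004:L43–L44).
* `IsTheta c r s` — «`c` is a cohomology class defined by a theta series, of bidegree `(rq, sq)`» (p0003:L82–L84).
* `IsBorelWallach c` — `c` is a theta class of bidegree `(q, 0)` in the unitary case, display (BW) p0003:L86–L89
  (these are the `IsTheta c 1 0` classes; kept as its own predicate because the remark after Théorème 1.2 names them). -/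
structure ThetaClassData (Cls G : Type) [AddCommGroup Cls] [Module ℂ Cls] [Group G] where
  p : ℕ
  q : ℕ
  one : Cls
  cup : Cls → Cls → Cls
  act : G → Cls → Cls
  conj : Cls → Cls
  IsTheta : Cls → ℕ → ℕ → Prop
  IsBorelWallach : Cls → Prop

variable {Cls G : Type} [AddCommGroup Cls] [Module ℂ Cls] [Group G]

namespace ThetaClassData

variable (T : ThetaClassData Cls G)

/-- The iterated cup product `c₁ ∧ c₂ ∧ … ∧ c_n` of a list of classes (right fold with the unit). -/
def cupList (l : List Cls) : Cls := l.foldr T.cup T.one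

end ThetaClassData

/-- **[BP] Théorème 1.1, first bullet (cup-product compatibility of the Schwartz forms), read at the level of
theta classes through display (cp)** (p0003:L22–L47 bullet 1; (cp) p0017:L24–L28: «Posons φ = φ_1 ⊗ φ_2 … on a
θ(ĩ_0(g_1′, g_2′), φ) = θ(g_1′, φ_1) ∧ θ(g_2′, φ_2)»): the cup product of a theta class of bidegree `(r₁q, s₁q)` and
one of bidegree `(r₂q, s₂q)` is (the class of) the theta series of bidegree `((r₁+r₂)q, (s₁+s₂)q)` attached to the
product Schwartz function and the embedded pair — so it is again a theta class of that bidegree.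
(«φ^{(rq,sq)} = 0 si r ou s est strictement supérieur à p» — the zero class is a theta class of every bidegree
beyond `p`; the interface imposes nothing there.) -/
def Bergeron2006_cupProduct_compat (T : ThetaClassData Cls G) : Prop :=
  ∀ (c₁ c₂ : Cls) (r₁ s₁ r₂ s₂ : ℕ), T.IsTheta c₁ r₁ s₁ → T.IsTheta c₂ r₂ s₂ →
    T.IsTheta (T.cup c₁ c₂) (r₁ + r₂) (s₁ + s₂)

/-- **[BP] display (BW), p0003:L86–L89** (Kazhdan, Shimura, Borel–Wallach, as cited there): in the unitary case and
for `(r, s) = (1, 0)`, `[θ(g′, φ)] ≠ 0 dans H^q(Sh^0 G)` — every Borel–Wallach class is non-zero; and such a class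
is a theta class of bidegree `(q, 0)` (p0003:L85–L86). -/
def Bergeron2006_BW_nonzero (T : ThetaClassData Cls G) : Prop :=
  ∀ c : Cls, T.IsBorelWallach c → c ≠ 0 ∧ T.IsTheta c 1 0

/-- The Hecke translates and conjugates of theta classes are theta classes (p0004:L9–L11: «on a même une action de
tout le groupe G(𝔸_f) sur les classes définies par des séries thêta : celle induite par l'action de G(𝔸_f) sur
φ ∈ 𝒮(X(𝔸_f))»; p0004:L19–L21 with p0004:L43–L44: the conjugate of the `(q,0)` Schwartz form is the `(0,q)` one). -/
def Bergeron2006_theta_stable (T : ThetaClassData Cls G) : Prop :=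
  (∀ (g : G) (c : Cls) (r s : ℕ), T.IsTheta c r s → T.IsTheta (T.act g c) r s) ∧
  (∀ (c : Cls) (r s : ℕ), T.IsTheta c r s → T.IsTheta (T.conj c) s r)

/-- **[BP] Théorème 1.2** (p0004:L13–L17), VERBATIM: «Soient `[θ(g_i′, φ_i)] ∈ H^*(Sh^0 G)`, `i = 1, 2`, deux classes
de cohomologie définies par des séries thêta et de bidegrés respectifs `(r_i q, s_i q)`, `i = 1, 2`. Supposons
`r_1 + r_2 ≤ p` et `s_1 + s_2 ≤ p`, il existe alors un élément `g ∈ G(𝔸_f)` tel que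
`[θ(g_1′, φ_1)] ∧ g([θ(g_2′, φ_2)]) ≠ 0` dans `H^{(r_1+r_2+s_1+s_2)q}(Sh^0 G)`.»
Typed over `ThetaClassData`: for theta classes `c₁, c₂` of bidegrees `(r₁, s₁)`, `(r₂, s₂)` (in units of `q`) with
`r₁ + r₂ ≤ p` and `s₁ + s₂ ≤ p` there is a Hecke translate `g` with `c₁ ∧ g(c₂) ≠ 0`.
WHAT IS PRINTED AND WHAT IS NOT: the theorem is for classes DEFINED BY THETA SERIES, i.e. `[θ(g′, φ)]` at a fixed
`g′` — it says nothing about the `μ`-isotypic component (the theta lift of ONE `U(1)`-character `μ`) of such a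
class; the Picard-modular case of (P) is `p = 2`, `q = 1`, `(r₁, s₁) = (2, 0)`, `(r₂, s₂) = (0, 2)`. -/
def Bergeron2006_Thm1_2 (T : ThetaClassData Cls G) : Prop :=
  ∀ (c₁ c₂ : Cls) (r₁ s₁ r₂ s₂ : ℕ), T.IsTheta c₁ r₁ s₁ → T.IsTheta c₂ r₂ s₂ →
    r₁ + r₂ ≤ T.p → s₁ + s₂ ≤ T.p → ∃ g : G, T.cup c₁ (T.act g c₂) ≠ 0

/-- **[BP] the remark after Théorème 1.2** (p0004:L19–L22), VERBATIM: «Il est ainsi plaisant de remarquer que, dans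
le cas unitaire et partant d'une classe de Borel-Wallach ((BW)) `η ∈ H^{(q,0)}(Sh^0 G)`, il est possible en formant
des cup-produits `η_1 ∧ … ∧ η_r ∧ η̄_1 ∧ … ∧ η̄_s`, où les `η_i` (resp. `η̄_j`) sont des translatés de Hecke de `η`
(resp. `η̄`), d'obtenir des classes non nulles dans `H^{(rq,sq)}(Sh^0 G)` pour `r, s ≤ p`.»
Typed: for a Borel–Wallach class `η` and `r, s ≤ p` there are Hecke translates `g : Fin r → G`, `h : Fin s → G` with
`(g 0 η) ∧ … ∧ (g (r-1) η) ∧ (h 0 η̄) ∧ … ∧ (h (s-1) η̄) ≠ 0`.  (The printed remark is a consequence of Théorème 1.2 +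
(cp); it is recorded separately because its `r = s = 2`, `p = 2`, `q = 1` instance has the SHAPE of (P) — a non-zero
`(2,2)`-class on a Picard modular surface as a wedge of four Hecke-translated `(1,0)`/`(0,1)` theta classes — with
ONE Borel–Wallach class `η` and its conjugate in place of the four prescribed `U(1)`-lifts `θ(μ_0), …, θ(μ_3)`.) -/
def Bergeron2006_Thm1_2_remark (T : ThetaClassData Cls G) : Prop :=
  ∀ (η : Cls), T.IsBorelWallach η → ∀ (r s : ℕ), r ≤ T.p → s ≤ T.p →
    ∃ (g : Fin r → G) (h : Fin s → G),
      T.cupList ((List.ofFn fun i => T.act (g i) η) ++ (List.ofFn fun j => T.act (h j) (T.conj η))) ≠ 0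

/-- The `(2,2)`-instance of the remark on a `p = 2`, `q = 1` quotient, spelled out (no `List`): for a Borel–Wallach
class `η` there are four Hecke translates `g₀ g₁ g₂ g₃` with `(g₀η) ∧ (g₁η) ∧ (g₂η̄) ∧ (g₃η̄) ≠ 0`.  This is the
instance `r = s = 2` of `Bergeron2006_Thm1_2_remark` when `T.p = 2` (stated for any `T`; a consumer checks `T.p = 2`). -/
def Bergeron2006_Thm1_2_remark_22 (T : ThetaClassData Cls G) : Prop :=
  ∀ (η : Cls), T.IsBorelWallach η → 2 ≤ T.p →
    ∃ g₀ g₁ g₂ g₃ : G,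
      T.cup (T.act g₀ η) (T.cup (T.act g₁ η) (T.cup (T.act g₂ (T.conj η)) (T.act g₃ (T.conj η)))) ≠ 0

/-! ## §4 of [BP]: the Kudla–Millson expansion and the Siegel–Weil non-vanishing (rows I-t4-lit-5-17 … 20)
The objects of §4 are finer than `ThetaClassData`: the theta class as a FUNCTION of `g′ ∈ G̃′(ℝ)`, the special-cycle
classes `[β, φ]` indexed by totally positive semi-definite hermitian `r × r` matrices `β`, the generalised Whittaker
functions `W_β(g′)`, and the integration functional `I : H^*(Sh(G)) → ℂ`.  `SiegelWeilData` carries them. -/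

/-- The data of [BP] §4 (`r = p`, `s = 0` or `s = p`; «Les formes que nous considérons sont alors celles considérées
par Kudla et Millson», p0017:L46–L47):
* `GR` — the real metaplectic group `G̃′(ℝ) ⊂ G̃′(𝔸)` (p0019:L4); `Schwartz` — `𝒮(V(𝔸_f)^r)` (p0019:L4).
* `theta g′ φ` — the class `[θ(g′, φ)] ∈ H^*(Sh(G))` (p0017:L47: «La notation [θ(g′, φ)] désigne dorénavant une
  classe dans H^*(Sh(G))»), in the ℂ-space `Cls` (parameter).
* `Beta` — the hermitian (resp. symmetric) `r × r` matrices over `K` that are totally positive semi-definite, the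
  index set «`β ≥ 0`» of Théorème 4.2; `cycleClass β φ` — `[β, φ] := c_q^{r − rang(β)} · [β, φ]^0` (p0018:L92);
  `W β g′` — `W_β(g′)` (p0019:L1, the product over the archimedean places).
* `I` — the integration functional `I : H^*(Sh(G)) = lim_→K H^*(Sh(G)_K) → ℂ`, `[η] ↦ vol(K/(K ∩ Z(ℚ))) · ∫_{Sh(G)_K} η`
  (p0020:L17–L28); `eisenstein g′ s φ` — the Siegel–Eisenstein series `E(g′, s; f)` with `f = f_∞ ⊗ φ`
  (p0019:L56–L72, `f_∞` p0020:L52–L56).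
The sum «`Σ_{β ≥ 0}`» of Théorème 4.2 is typed as a finite sum over a `Finset` of `Beta` (the class lives in a fixed
`H^*(Sh(G)_K)` where finitely many `β` contribute for a given `φ` — the page prints the sum without a finiteness
remark; a consumer that needs the infinite-sum reading must add it as a hypothesis). -/
structure SiegelWeilData (Cls : Type) [AddCommGroup Cls] [Module ℂ Cls] where
  GR : Type
  Schwartz : Type
  theta : GR → Schwartz → Cls
  Beta : Type
  cycleClass : Beta → Schwartz → Cls
  W : Beta → GR → ℂ
  I : Cls → ℂ
  eisenstein : GR → ℂ → Schwartz → ℂ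

/-- **[BP] Théorème 4.2 (FD)** (p0019:L3–L6), VERBATIM: «Étant donnés `g′ ∈ G̃′(ℝ) ⊂ G̃′(𝔸)` et `φ ∈ S(V(𝔸_f)^r)`,
`[θ(g′, φ)] = Σ_{β ≥ 0} [β, φ] W_β(g′)`.»  Typed with a finite index set `S φ` of the contributing `β` (see the
structure docstring). -/
def Bergeron2006_Thm4_2 (D : SiegelWeilData Cls) : Prop :=
  ∀ φ : D.Schwartz, ∃ S : Finset D.Beta,
    ∀ g' : D.GR, D.theta g' φ = ∑ β ∈ S, D.W β g' • D.cycleClass β φ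

/-- **[BP] Corollaire 4.5** (p0020:L60–L69), VERBATIM: «Soit `φ ∈ S(V(𝔸_f)^p)` et `f = f_∞ ⊗ φ`. Alors, il existe une
constante `c′ > 0`, qui ne dépend que des choix de mesures, telle que `I([θ(g′, φ)]) = c′ · E(g′, ½, f)`. En
particulier, cette fonction est non nulle comme fonction de `g′` (les séries d'Eisenstein sont non nulles et
analytiques réelles en `g′`).»  Typed: one constant `c′ > 0` (for all `φ` and `g′`, since it depends only on the
measures) with `I(θ(g′, φ)) = c′ · E(g′, ½, f_∞ ⊗ φ)`, and for every `φ` some `g′` with `E(g′, ½, f) ≠ 0`.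
(The corollary's last sentence — «[θ(g′, φ)] est non nulle pour tout g′ et les théorèmes (T2) et (T3) s'en déduisent» —
is the conclusion drawn from (FD) + this; it is not re-typed.)  Its hypothesis is Théorème 4.3 = the Siegel–Weil
formula (Ichino 2007 in the unitary case, p0019:L74–L84) — held restatement GQT14 Thm 18, seat t4-lit-6's row. -/
def Bergeron2006_Cor4_5 (D : SiegelWeilData Cls) : Prop :=
  ∃ c' : ℝ, 0 < c' ∧
    (∀ (g' : D.GR) (φ : D.Schwartz), D.I (D.theta g' φ) = (c' : ℂ) * D.eisenstein g' (1/2 : ℂ) φ) ∧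
    (∀ φ : D.Schwartz, ∃ g' : D.GR, D.eisenstein g' (1/2 : ℂ) φ ≠ 0)

/-- **[BP] Corollaire 4.5, the drawn conclusion** (p0020:L66–L69): «on en déduit que `[θ(g′, φ)]` est non nulle pour
tout `g′`» — for `r = p`, `s = 0` (resp. `s = p`) the class `[θ(g′, φ)] ∈ H^*(Sh(G))` is non-zero for every `g′`
(and every `φ` — the page's `φ` is the fixed Schwartz function of the corollary).  Stated as the page does, for all
`g′` and `φ`; a consumer must remember the `φ` for which `E(·, ½, f) ≢ 0` is the one meant (Cor 4.5 gives it for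
every `φ`: «les séries d'Eisenstein sont non nulles»). -/
def Bergeron2006_Cor4_5_conclusion (D : SiegelWeilData Cls) : Prop :=
  ∀ (g' : D.GR) (φ : D.Schwartz), D.theta g' φ ≠ 0

end Summit.Ventures.HodgeRepro.Tier4.Lit

end
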